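import Literature.MathematicalPhysics.QuantumFieldTheory.Balaban1983to89.B6Eq295
import Literature.MathematicalPhysics.QuantumFieldTheory.Balaban1983to89.B6Eq232GaussianMoment
import Literature.MathematicalPhysics.QuantumFieldTheory.Balaban1983to89.B6Eq230GaussianRoute

/-!
# `Balaban1983to89.B6Eq226CovarianceMoments` — T. Bałaban, *Propagators and renormalization transformations for
# lattice gauge theories. II*, Commun. Math. Phys. **96** (1984) 223–250 [Balaban1984PropagatorsII], Sect. A
# (2.25)–(2.27) pp. 226–227: *"Let us denote by 𝒢 a covariance of the Gaussian integral on the right-hand side above.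
# Thus we have R = Δ𝒢Δ. (2.26)"* — the COVARIANCE of the constrained Gaussian (2.25) in the probabilistic sense (its
# second moments) HAS the three characterising properties of `…B6SectA.covariance_unique`; hence 𝒢 = (2.27), and
# (2.26) follows from (2.25) AS PRINTED

statement-level skeleton of published theorems with citation tags; proofs where landed; nothing here is a claim about the Yang–Mills mass gap

PDF held: `paper:balaban1984-cmp96-propagators-rt-ii` (journal page = PDF page + 222); pp. 226–227 read AS IMAGES on the
×2 renders `run/shared/lean/pub/pub-balaban/b2b-balaban-ref1/pages/1984-cmp96-propagators-rt-II/…-p004-x2.png`,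
`…-p005-x2.png` by this seat (2026-08-21).

CITATION HEADER (lean-in-tree rule).  WHAT IS REPRODUCED: lit-balaban SKELETON rows **B6.Eq2.24** ((2.24)–(2.26) p. 226;
cell: *"NOT formalised: the textbook fact that the covariance of the Gaussian measure (2.25) has the three characterising
properties"*) and **B6.Eq2.27** ((2.27) p. 227) — the one analytic input that r03's `…B6SectA` §5 leaves open verbatim:
*"(a textbook property of Gaussian covariances, which is the only analytic input and is not formalised here)"*.
PHASE-2 proof seat p22 (gen 6), unit `lit-balaban-p22-g6`; owner r03, referee ref-4; HOME `run/shared/lean/pub/lit-balaban/`.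
Theorems only; nothing of an existing module is restated or modified — CONSUMED by name: (2.25) = `…B6Eq295.eq225`
(r03), the (2.27) uniqueness step `…B6SectA.eq_calG_of_covariance` and the (2.26)+(2.27) ⇒ (2.17) algebra
`…B6SectA.conj_calG_eq_lap_calG_lap`/`deltaPrime_calG_deltaPrime` (r03), the Gaussian second moment
`…B6Eq232GaussianMoment.integral_gauss_bilinear`, the moment-generating function `…B6Eq295.integral_exp_quadratic_add_linear`
and the convergence `…B6Eq230GaussianRoute.Z_pos`.

PRINT (pp. 226–227 [PDF 4–5], verbatim).  *"At first we will write an integral representation of the operator R,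
analogous to the representation (1.27). By the formula (2.17) and properties of Gaussian integrals we have
  e^{−½⟨f,Rf⟩} = e^{−½‖f‖²}(Z′⁻¹∫dλδ(Q′λ)e^{−½‖f−Δλ‖²})⁻¹   (2.24)
or   e^{½⟨f,Rf⟩} = Z′⁻¹∫dλδ(Q′λ)e^{−½‖Δλ‖² + ⟨Δf,λ⟩}.   (2.25)
Let us denote by 𝒢 a covariance of the Gaussian integral on the right-hand side above. Thus we have
  R = Δ𝒢Δ.   (2.26)
It is easy to see that   𝒢 = G′² − G′²Q′*(Q′G′²Q′*)⁻¹Q′G′².   (2.27)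
This formula, the equality (2.26) and the equalities Q′𝒢 = 𝒢Q′* = 0 imply the representation (2.17)."*
Context: `R` = *"an orthogonal projection in the space L²(T_η) onto the subspace ΔN(Q′)"* (p. 225, (2.10)); `N(Q′)` =
the gauge space (2.7)/(2.10) = `…B6SectA.gaugeSpace Q′ = ker Q′`; `Δ′_a = Δ + Q′*aQ′` ((2.13)–(2.14), `…B6SectA.deltaPrime`),
equal to `Δ` on `N(Q′)`; `G′ = Δ′_a⁻¹`; (2.11): *"the Laplace operator Δ is positive on the subspace N(Q′), hence it is
invertible on this subspace"*.

HOW IT IS TYPED.  As in `…B6Eq2117FaddeevPopov.Ztilde_pos`/`forms_eq_of_fp` (this seat, gen 5): `∫dλ δ(Q′λ) F(λ)` is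
the integral of `F` over the SUBTYPE `↥(gaugeSpace Q′)` of the finite-dimensional real inner-product space `V` of scalar
functions against ANY additive Haar (= Lebesgue) measure `μ′` on it; `Z′ = ∫dλδ(Q′λ)e^{−½‖Δλ‖²}`.  *"A covariance of
the Gaussian integral"* in the probabilistic sense is an operator `T` on `V` whose matrix elements are the second
moments of the probability measure `Z′⁻¹δ(Q′λ)e^{−½‖Δλ‖²}dλ` (which is centred, `mean_zero`):
  `⟨a, Tb⟩ · Z′ = ∫dλ δ(Q′λ) e^{−½‖Δλ‖²} ⟨λ,a⟩⟨λ,b⟩`   (hypothesis `hT`; such a `T` EXISTS and is UNIQUE).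
The only hypotheses are the printed structure: `Δ` symmetric and injective on `N(Q′)` ((2.11)).

CONTENTS (all `theorem`s).  §1 The textbook fact for a symmetric `S` coercive on a subspace `K` (Gaussian `e^{−½⟨k,Sk⟩}`
on `K`): `gaussian_integrable_pos` (`Z_K > 0`), `mean_zero`, **`covariance_exists`** (an operator with range in `K`,
symmetric, inverting the form on `K`, whose matrix elements ARE the second moments and whose quadratic form gives the
moment-generating function — the compression `ι*Sι` of `S` to `K`, inverted), `covariance_unique_of_moments`,
**`covariance_of_moments`** (ANY operator with the second-moment identity has these properties).  §2 The letters of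
(2.25)–(2.27): `coercive_of_inj` ((2.11) ⇒ `γ‖λ‖² ≤ ‖Δλ‖²` on `N(Q′)`), `cov225_exists`, **`cov225`** ((a) `T` maps into
`N(Q′)`, (b) `T` symmetric, (c) `T(Δ²λ) = λ` on `N(Q′)` — literally `hTr/hTs/hTi` of `…B6SectA.covariance_unique` — and
(d) `∫dλδ(Q′λ)e^{−½‖Δλ‖²+⟨λ,J⟩} = e^{½⟨J,TJ⟩}Z′`), **`eq226_gaussian`** (*"Thus we have R = Δ𝒢Δ"*: (2.25) and (d) at
`J = Δf` give `e^{½⟨f,Rf⟩}Z′ = e^{½⟨Δf,TΔf⟩}Z′`, `Z′ > 0`, then polarization: `Rf = Δ(T(Δf))`), **`eq227_gaussian`**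
(`T = …B6SectA.calG G′ Q′ Q′* E` = (2.27)), `eq217_gaussian` (*"… imply the representation (2.17)"*, the printed
chain end-to-end by the Gaussian route; the direct proof is r03's `…B6SectA.starProjection_eq_repr217`).
READINGS.  (a) `V` finite-dimensional = the paper's situation (functions on a finite torus).  (b) "a covariance"
(indefinite article): as an operator on all of `L²`, a covariance of a measure carried by `N(Q′)` is pinned down only
together with `Q′𝒢 = 𝒢Q′* = 0` (p. 227); the second-moment operator `T` is that one, and it is unique
(`covariance_unique_of_moments`).  (c) All Gaussians here are integrable (`gaussian_integrable_pos`): no junk `∫ = 0`.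
Unit `lit-balaban-p22` (PHASE-2 proof seat, gen 6), HOME `run/shared/lean/pub/lit-balaban/`, 2026-08-21.
v1.1 (append-only, same seat): `h226_of_cov` — (2.26) in the bilinear form `⟨x,Ry⟩ = ⟨Δx,𝒢Δy⟩`, i.e. exactly the
hypothesis `h226` of `…B6Eq228FaddeevPopov.eq230_line3_calG` (the third line of (2.30): *"The last equality follows
from the identity (2.26)"*), now supplied by the covariance of (2.25).
-/

noncomputable section

open MeasureTheory
open scoped InnerProductSpace

namespace Literature.MathematicalPhysics.QuantumFieldTheory.Balaban1983to89.B6Eq226CovarianceMoments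

/-! ## §1  The covariance of a centred Gaussian carried by a subspace (the textbook fact) -/

section Subspace

variable {V : Type*} [NormedAddCommGroup V] [InnerProductSpace ℝ V] [FiniteDimensional ℝ V]
  [MeasurableSpace V] [BorelSpace V]

omit [MeasurableSpace V] [BorelSpace V] in
/-- The compression `ι*Sι` of `S` to the subspace `K` (`ι` the inclusion, `ι*` its adjoint) has the matrix elements
of `S`: `⟨k, ι*Sι k′⟩_K = ⟨k, Sk′⟩_V`. [cite: Balaban1984PropagatorsII, (2.25) p.226] -/
theorem inner_compression (K : Submodule ℝ V) (S : V →ₗ[ℝ] V) (k k' : ↥K) :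
    ⟪k, (LinearMap.adjoint K.subtype ∘ₗ S ∘ₗ K.subtype) k'⟫_ℝ = ⟪(k : V), S k'⟫_ℝ := by
  simp only [LinearMap.coe_comp, Function.comp_apply, Submodule.coe_subtype]
  rw [LinearMap.adjoint_inner_right]
  rfl

/-- **`Z_K > 0`.**  For `S` coercive on the subspace `K` (`γ‖k‖² ≤ ⟨k,Sk⟩`, `γ > 0`) the Gaussian `e^{−½⟨k,Sk⟩}` is
integrable for every additive Haar (Lebesgue) measure on `K` and `Z_K = ∫_K e^{−½⟨k,Sk⟩} > 0` — the constrained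
normalisation `Z′ = ∫dλδ(Q′λ)e^{−½‖Δλ‖²}` of (2.24)–(2.25) is a convergent positive integral.
[cite: Balaban1984PropagatorsII, (2.24)–(2.25) p.226] -/
theorem gaussian_integrable_pos (K : Submodule ℝ V) (μ' : Measure ↥K) [μ'.IsAddHaarMeasure]
    (S : V →ₗ[ℝ] V) {γ : ℝ} (hγ : 0 < γ) (hcoer : ∀ k : ↥K, γ * ‖(k : V)‖ ^ 2 ≤ ⟪(k : V), S k⟫_ℝ) :
    Integrable (fun k : ↥K => Real.exp (-(1 / 2) * ⟪(k : V), S k⟫_ℝ)) μ' ∧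
      0 < ∫ k : ↥K, Real.exp (-(1 / 2) * ⟪(k : V), S k⟫_ℝ) ∂μ' := by
  set M' : ↥K →ₗ[ℝ] ↥K := LinearMap.adjoint K.subtype ∘ₗ S ∘ₗ K.subtype
  have hM' : ∀ k : ↥K, ⟪k, M' k⟫_ℝ = ⟪(k : V), S k⟫_ℝ := fun k => inner_compression K S k k
  have hpos' : ∀ k : ↥K, γ * ‖k‖ ^ 2 ≤ ⟪k, M' k⟫_ℝ := fun k => by
    rw [hM', Submodule.coe_norm]; exact hcoer k
  have h := B6Eq230GaussianRoute.Z_pos μ' M' hγ hpos'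
  simp_rw [hM'] at h
  exact h

/-- **The Gaussian is centred**: `∫_K e^{−½⟨k,Sk⟩}⟨k,a⟩ = 0` for every `a` (odd integrand, the Haar measure of `K` is
invariant under `k → −k`), so its second moments are its covariance. [cite: Balaban1984PropagatorsII, (2.25)–(2.26) p.226] -/
theorem mean_zero (K : Submodule ℝ V) (μ' : Measure ↥K) [μ'.IsAddHaarMeasure] (S : V →ₗ[ℝ] V) (a : V) :
    ∫ k : ↥K, Real.exp (-(1 / 2) * ⟪(k : V), S k⟫_ℝ) * ⟪(k : V), a⟫_ℝ ∂μ' = 0 := by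
  haveI : μ'.IsNegInvariant := inferInstance
  have h := integral_neg_eq_self (fun k : ↥K => Real.exp (-(1 / 2) * ⟪(k : V), S k⟫_ℝ) * ⟪(k : V), a⟫_ℝ) μ'
  simp only [Submodule.coe_neg, map_neg, inner_neg_left, inner_neg_right, neg_neg, mul_neg] at h
  rw [integral_neg] at h
  linarith

/-- **A covariance EXISTS, and it is the second-moment operator.**  For `S` symmetric and coercive on the subspace `K`
and any additive Haar measure `μ′` on `K` there is an operator `C` on `V` with: (a) range in `K`; (b) `C` symmetric;
(c) `C(Sk) = k` for `k ∈ K` (it inverts the form on `K`); (d) its matrix elements ARE the second moments,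
`∫_K e^{−½⟨k,Sk⟩}⟨k,a⟩⟨k,b⟩ dμ′ = ⟨a,Cb⟩·Z_K`; (e) its quadratic form gives the moment-generating function,
`∫_K e^{−½⟨k,Sk⟩+⟨k,J⟩} dμ′ = e^{½⟨J,CJ⟩}·Z_K` (*"properties of Gaussian integrals"*).  Construction: `C = ι(ι*Sι)⁻¹ι*`
with the compression `ι*Sι` of `S` to `K`; (d) is `…B6Eq232GaussianMoment.integral_gauss_bilinear` on `K`.
[cite: Balaban1984PropagatorsII, (2.25)–(2.27) pp.226–227] -/
theorem covariance_exists (K : Submodule ℝ V) (μ' : Measure ↥K) [μ'.IsAddHaarMeasure] (S : V →ₗ[ℝ] V)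
    (hS : ∀ x y : V, ⟪S x, y⟫_ℝ = ⟪x, S y⟫_ℝ) {γ : ℝ} (hγ : 0 < γ)
    (hcoer : ∀ k : ↥K, γ * ‖(k : V)‖ ^ 2 ≤ ⟪(k : V), S k⟫_ℝ) :
    ∃ C : V →ₗ[ℝ] V, (∀ v, C v ∈ K) ∧ (∀ x y : V, ⟪C x, y⟫_ℝ = ⟪x, C y⟫_ℝ) ∧ (∀ k : ↥K, C (S k) = k) ∧
      (∀ a b : V, ∫ k : ↥K, Real.exp (-(1 / 2) * ⟪(k : V), S k⟫_ℝ) * (⟪(k : V), a⟫_ℝ * ⟪(k : V), b⟫_ℝ) ∂μ' =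
        ⟪a, C b⟫_ℝ * ∫ k : ↥K, Real.exp (-(1 / 2) * ⟪(k : V), S k⟫_ℝ) ∂μ') ∧
      (∀ J : V, ∫ k : ↥K, Real.exp (-(1 / 2) * ⟪(k : V), S k⟫_ℝ + ⟪(k : V), J⟫_ℝ) ∂μ' =
        Real.exp ((1 / 2) * ⟪J, C J⟫_ℝ) * ∫ k : ↥K, Real.exp (-(1 / 2) * ⟪(k : V), S k⟫_ℝ) ∂μ') := by
  haveI : μ'.IsNegInvariant := inferInstance
  set ι : ↥K →ₗ[ℝ] V := K.subtype
  set ιa : V →ₗ[ℝ] ↥K := LinearMap.adjoint K.subtype with hιadef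
  set M' : ↥K →ₗ[ℝ] ↥K := LinearMap.adjoint K.subtype ∘ₗ S ∘ₗ K.subtype
  have hM' : ∀ k k' : ↥K, ⟪k, M' k'⟫_ℝ = ⟪(k : V), S k'⟫_ℝ := fun k k' => inner_compression K S k k'
  have hιa : ∀ (k : ↥K) (v : V), ⟪k, ιa v⟫_ℝ = ⟪(k : V), v⟫_ℝ := fun k v => by
    rw [hιadef, LinearMap.adjoint_inner_right]; rfl
  have hιa' : ∀ (v : V) (k : ↥K), ⟪ιa v, k⟫_ℝ = ⟪v, (k : V)⟫_ℝ := fun v k => by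
    rw [real_inner_comm, hιa, real_inner_comm]
  have hM'sym : ∀ x y : ↥K, ⟪M' x, y⟫_ℝ = ⟪x, M' y⟫_ℝ := by
    intro x y
    rw [real_inner_comm, hM', hM', ← hS, real_inner_comm]
  -- coercivity ⇒ the compression is injective, hence invertible on the finite-dimensional `K`
  have hM'inj : Function.Injective M' := by
    intro x y hxy
    have h1 : ⟪((x - y : ↥K) : V), S ((x - y : ↥K) : V)⟫_ℝ = 0 := by
      rw [← hM', map_sub, hxy, sub_self, inner_zero_right]
    have h2 : γ * ‖((x - y : ↥K) : V)‖ ^ 2 ≤ 0 := (hcoer _).trans_eq h1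
    have h3 : ‖((x - y : ↥K) : V)‖ ^ 2 ≤ 0 := by nlinarith [sq_nonneg ‖((x - y : ↥K) : V)‖]
    have h4 : ‖((x - y : ↥K) : V)‖ = 0 := by nlinarith [norm_nonneg ((x - y : ↥K) : V)]
    have h6 : (x - y : ↥K) = 0 := by exact_mod_cast norm_eq_zero.mp h4
    exact sub_eq_zero.mp h6
  set Ge : ↥K ≃ₗ[ℝ] ↥K := LinearEquiv.ofInjectiveEndo M' hM'inj
  set G : ↥K →ₗ[ℝ] ↥K := (Ge.symm : ↥K →ₗ[ℝ] ↥K)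
  have hGM' : ∀ k, G (M' k) = k := fun k => Ge.symm_apply_apply k
  have hMG' : ∀ k, M' (G k) = k := fun k => Ge.apply_symm_apply k
  have hMG : M' ∘ₗ G = LinearMap.id := by ext k; simp [hMG']
  have hGsym : ∀ x y : ↥K, ⟪G x, y⟫_ℝ = ⟪x, G y⟫_ℝ := by
    intro x y
    conv_lhs => rw [← hMG' y]
    rw [← hM'sym, hMG']
  -- the Gaussian on `K` in the compressed form
  have hpos' : ∀ k : ↥K, γ * ‖k‖ ^ 2 ≤ ⟪k, M' k⟫_ℝ := fun k => by
    rw [hM', Submodule.coe_norm]; exact hcoer k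
  obtain ⟨hint, -⟩ := B6Eq230GaussianRoute.Z_pos μ' M' hγ hpos'
  refine ⟨ι ∘ₗ G ∘ₗ ιa, ?_, ?_, ?_, ?_, ?_⟩
  · intro v
    exact (G (ιa v)).2
  · intro x y
    show ⟪((G (ιa x) : ↥K) : V), y⟫_ℝ = ⟪x, ((G (ιa y) : ↥K) : V)⟫_ℝ
    rw [← hιa', ← hιa, hGsym]
  · intro k
    show ((G (ιa (S (k : V))) : ↥K) : V) = (k : V)
    have : ιa (S (k : V)) = M' k := rfl
    rw [this, hGM']
  · intro a b
    have h := B6Eq232GaussianMoment.integral_gauss_bilinear μ' M' G hM'sym hMG hint (ιa a) (ιa b)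
    simp_rw [hM', hιa] at h
    rw [h]
    congr 1
    show ⟪((G (ιa b) : ↥K) : V), a⟫_ℝ = ⟪a, ((G (ιa b) : ↥K) : V)⟫_ℝ
    exact real_inner_comm _ _
  · intro J
    have h := B6Eq295.integral_exp_quadratic_add_linear μ' M' G hM'sym hMG (ιa J)
    simp_rw [hM', hιa] at h
    rw [h, hιa']
    rfl

omit [FiniteDimensional ℝ V] [MeasurableSpace V] [BorelSpace V] in
/-- **Uniqueness from the second moments:** two operators whose matrix elements (times a constant `Z ≠ 0`) are the
same moments coincide. [cite: Balaban1984PropagatorsII, (2.26) p.226] -/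
theorem covariance_unique_of_moments {Z : ℝ} (hZ : Z ≠ 0) (m : V → V → ℝ) (T₁ T₂ : V →ₗ[ℝ] V)
    (h₁ : ∀ a b : V, ⟪a, T₁ b⟫_ℝ * Z = m a b) (h₂ : ∀ a b : V, ⟪a, T₂ b⟫_ℝ * Z = m a b) : T₁ = T₂ := by
  refine LinearMap.ext fun b => ext_inner_left ℝ fun a => ?_
  exact mul_right_cancel₀ hZ ((h₁ a b).trans (h₂ a b).symm)

/-- **The textbook fact.**  Let `S` be symmetric and coercive on the subspace `K`, `μ′` an additive Haar measure on `K`,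
and let `T` be *a covariance of the Gaussian integral* `∫_K e^{−½⟨k,Sk⟩}(…)dμ′` in the probabilistic sense:
`⟨a,Tb⟩·Z_K = ∫_K e^{−½⟨k,Sk⟩}⟨k,a⟩⟨k,b⟩dμ′` for all `a, b`.  Then (a) `T` maps into `K`, (b) `T` is symmetric,
(c) `T(Sk) = k` for every `k ∈ K`, and (d) `∫_K e^{−½⟨k,Sk⟩+⟨k,J⟩}dμ′ = e^{½⟨J,TJ⟩}Z_K` for every source `J`.
[cite: Balaban1984PropagatorsII, (2.25)–(2.27) pp.226–227] -/
theorem covariance_of_moments (K : Submodule ℝ V) (μ' : Measure ↥K) [μ'.IsAddHaarMeasure] (S : V →ₗ[ℝ] V)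
    (hS : ∀ x y : V, ⟪S x, y⟫_ℝ = ⟪x, S y⟫_ℝ) {γ : ℝ} (hγ : 0 < γ)
    (hcoer : ∀ k : ↥K, γ * ‖(k : V)‖ ^ 2 ≤ ⟪(k : V), S k⟫_ℝ) (T : V →ₗ[ℝ] V)
    (hT : ∀ a b : V, ⟪a, T b⟫_ℝ * ∫ k : ↥K, Real.exp (-(1 / 2) * ⟪(k : V), S k⟫_ℝ) ∂μ' =
      ∫ k : ↥K, Real.exp (-(1 / 2) * ⟪(k : V), S k⟫_ℝ) * (⟪(k : V), a⟫_ℝ * ⟪(k : V), b⟫_ℝ) ∂μ') :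
    (∀ v, T v ∈ K) ∧ (∀ x y : V, ⟪T x, y⟫_ℝ = ⟪x, T y⟫_ℝ) ∧ (∀ k : ↥K, T (S k) = k) ∧
      (∀ J : V, ∫ k : ↥K, Real.exp (-(1 / 2) * ⟪(k : V), S k⟫_ℝ + ⟪(k : V), J⟫_ℝ) ∂μ' =
        Real.exp ((1 / 2) * ⟪J, T J⟫_ℝ) * ∫ k : ↥K, Real.exp (-(1 / 2) * ⟪(k : V), S k⟫_ℝ) ∂μ') := by
  obtain ⟨C, hCr, hCs, hCi, hCm, hCmgf⟩ := covariance_exists K μ' S hS hγ hcoer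
  have hZ := (gaussian_integrable_pos K μ' S hγ hcoer).2.ne'
  have hTC : T = C :=
    covariance_unique_of_moments hZ _ T C hT (fun a b => by rw [hCm a b])
  rw [hTC]
  exact ⟨hCr, hCs, hCi, hCmgf⟩

end Subspace

/-! ## §2  (2.25) ⇒ (2.26) ⇒ (2.27) in the letters of Sect. A -/

section SectA

variable {V W : Type*} [NormedAddCommGroup V] [InnerProductSpace ℝ V] [FiniteDimensional ℝ V]
  [MeasurableSpace V] [BorelSpace V] [NormedAddCommGroup W] [InnerProductSpace ℝ W]

omit [FiniteDimensional ℝ V] [MeasurableSpace V] [BorelSpace V] in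
/-- `⟨x, Δ²x⟩ = ‖Δx‖²` for symmetric `Δ`. [cite: Balaban1984PropagatorsII, (2.25) p.226] -/
theorem inner_lap_lap (lap : V →ₗ[ℝ] V) (hlap : ∀ x y : V, ⟪lap x, y⟫_ℝ = ⟪x, lap y⟫_ℝ) (x : V) :
    ⟪x, (lap ∘ₗ lap) x⟫_ℝ = ‖lap x‖ ^ 2 := by
  rw [LinearMap.comp_apply, ← hlap, real_inner_self_eq_norm_sq]

variable (Qp : V →ₗ[ℝ] W) (μ' : Measure ↥(B6SectA.gaugeSpace Qp)) [μ'.IsAddHaarMeasure] (lap : V →ₗ[ℝ] V)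
  (hlap : ∀ x y : V, ⟪lap x, y⟫_ℝ = ⟪x, lap y⟫_ℝ) (hDinj : ∀ n ∈ B6SectA.gaugeSpace Qp, lap n = 0 → n = 0)

include hlap in
omit [FiniteDimensional ℝ V] [MeasurableSpace V] [BorelSpace V] in
/-- `Δ²` is symmetric. [cite: Balaban1984PropagatorsII, (2.25) p.226] -/
theorem lap_lap_symm (x y : V) : ⟪(lap ∘ₗ lap) x, y⟫_ℝ = ⟪x, (lap ∘ₗ lap) y⟫_ℝ := by
  simp only [LinearMap.comp_apply]; rw [hlap, hlap]

include hlap hDinj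

omit [MeasurableSpace V] [BorelSpace V] in
/-- **(2.11) ⇒ coercivity of `‖Δλ‖²` on `N(Q′)`:** if *"the Laplace operator Δ is … invertible on this subspace"*
(`Δ` injective on `N(Q′)`; finite dimension), there is `γ > 0` with `γ‖λ‖² ≤ ⟨λ,Δ²λ⟩ = ‖Δλ‖²` for all `λ ∈ N(Q′)`.
[cite: Balaban1984PropagatorsII, (2.11) p.225] -/
theorem coercive_of_inj :
    ∃ γ : ℝ, 0 < γ ∧ ∀ k : ↥(B6SectA.gaugeSpace Qp), γ * ‖(k : V)‖ ^ 2 ≤ ⟪(k : V), (lap ∘ₗ lap) k⟫_ℝ := by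
  set D : ↥(B6SectA.gaugeSpace Qp) →ₗ[ℝ] V := lap ∘ₗ (B6SectA.gaugeSpace Qp).subtype with hD
  have hDinj' : Function.Injective D := by
    intro x y hxy
    have h0 : lap ((x : V) - (y : V)) = 0 := by
      have : D x - D y = 0 := sub_eq_zero.mpr hxy
      simpa [hD, map_sub] using this
    exact Subtype.ext (sub_eq_zero.mp (hDinj _ (Submodule.sub_mem _ x.2 y.2) h0))
  obtain ⟨Kc, hKc, hanti⟩ := (LinearMap.injective_iff_antilipschitz D).mp hDinj'
  refine ⟨((Kc : ℝ) ^ 2)⁻¹, by positivity, fun k => ?_⟩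
  have hb : ‖k‖ ≤ Kc * ‖D k‖ := ZeroHomClass.bound_of_antilipschitz D hanti k
  have hDk : D k = lap (k : V) := rfl
  rw [inner_lap_lap lap hlap, ← Submodule.coe_norm, ← hDk, inv_mul_le_iff₀ (by positivity)]
  have h2 : ‖k‖ ^ 2 ≤ ((Kc : ℝ) * ‖D k‖) ^ 2 := pow_le_pow_left₀ (norm_nonneg _) hb 2
  nlinarith [h2]

/-- **Existence** of a covariance of (2.25) in the probabilistic (second-moment) sense, with `Z′ > 0`, under (2.11):
`μ′` any additive Haar measure on `N(Q′) = ker Q′` ("`dλ δ(Q′λ)`"), `Z′ = ∫dλδ(Q′λ)e^{−½‖Δλ‖²}`.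
[cite: Balaban1984PropagatorsII, (2.25)–(2.26) p.226] -/
theorem cov225_exists :
    0 < ∫ l : ↥(B6SectA.gaugeSpace Qp), Real.exp (-(1 / 2) * ‖lap (l : V)‖ ^ 2) ∂μ' ∧
    ∃ T : V →ₗ[ℝ] V, ∀ a b : V,
      ⟪a, T b⟫_ℝ * ∫ l : ↥(B6SectA.gaugeSpace Qp), Real.exp (-(1 / 2) * ‖lap (l : V)‖ ^ 2) ∂μ' =
        ∫ l : ↥(B6SectA.gaugeSpace Qp), Real.exp (-(1 / 2) * ‖lap (l : V)‖ ^ 2) *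
          (⟪(l : V), a⟫_ℝ * ⟪(l : V), b⟫_ℝ) ∂μ' := by
  obtain ⟨γ, hγ, hcoer⟩ := coercive_of_inj Qp lap hlap hDinj
  have hZ := (gaussian_integrable_pos (B6SectA.gaugeSpace Qp) μ' (lap ∘ₗ lap) hγ hcoer).2
  obtain ⟨C, -, -, -, hCm, -⟩ :=
    covariance_exists (B6SectA.gaugeSpace Qp) μ' (lap ∘ₗ lap) (lap_lap_symm lap hlap) hγ hcoer
  simp_rw [inner_lap_lap lap hlap] at hZ hCm
  exact ⟨hZ, C, fun a b => (hCm a b).symm⟩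

variable (T : V →ₗ[ℝ] V)
  (hT : ∀ a b : V, ⟪a, T b⟫_ℝ * ∫ l : ↥(B6SectA.gaugeSpace Qp), Real.exp (-(1 / 2) * ‖lap (l : V)‖ ^ 2) ∂μ' =
    ∫ l : ↥(B6SectA.gaugeSpace Qp), Real.exp (-(1 / 2) * ‖lap (l : V)‖ ^ 2) * (⟪(l : V), a⟫_ℝ * ⟪(l : V), b⟫_ℝ) ∂μ')

include hT

/-- **The covariance of (2.25) has the three characterising properties** (= the hypotheses `hTr`, `hTs`, `hTi` of
`…B6SectA.covariance_unique` / `eq_calG_of_covariance`), and the right-hand side of (2.25) IS the Gaussian with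
covariance `T` (*"properties of Gaussian integrals"*).  Let `Δ` be symmetric and injective on `N(Q′) = ker Q′`
((2.11)), `μ′` any additive Haar measure on `N(Q′)` ("`dλ δ(Q′λ)`"), `Z′ = ∫dλδ(Q′λ)e^{−½‖Δλ‖²}`, and `T` a
covariance of the Gaussian integral (2.25): `⟨a,Tb⟩·Z′ = ∫dλδ(Q′λ)e^{−½‖Δλ‖²}⟨λ,a⟩⟨λ,b⟩` (`hT`).  Then (a) `T` maps
into `N(Q′)`, (b) `T` is symmetric, (c) `T(Δ²λ) = λ` for `λ ∈ N(Q′)`, (d) for every source `J`,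
`∫dλδ(Q′λ)e^{−½‖Δλ‖²+⟨λ,J⟩} = e^{½⟨J,TJ⟩}·Z′` (at `J = Δf`: the integral of (2.25), `⟨Δf,λ⟩ = ⟨λ,Δf⟩`).
[cite: Balaban1984PropagatorsII, (2.25)–(2.27) pp.226–227] -/
theorem cov225 :
    (∀ u, T u ∈ B6SectA.gaugeSpace Qp) ∧ (∀ x y : V, ⟪T x, y⟫_ℝ = ⟪x, T y⟫_ℝ) ∧
      (∀ n ∈ B6SectA.gaugeSpace Qp, T (lap (lap n)) = n) ∧
      ∀ J : V, ∫ l : ↥(B6SectA.gaugeSpace Qp), Real.exp (-(1 / 2) * ‖lap (l : V)‖ ^ 2 + ⟪(l : V), J⟫_ℝ) ∂μ' =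
        Real.exp ((1 / 2) * ⟪J, T J⟫_ℝ) *
          ∫ l : ↥(B6SectA.gaugeSpace Qp), Real.exp (-(1 / 2) * ‖lap (l : V)‖ ^ 2) ∂μ' := by
  obtain ⟨γ, hγ, hcoer⟩ := coercive_of_inj Qp lap hlap hDinj
  have hT' : ∀ a b : V, ⟪a, T b⟫_ℝ *
      ∫ l : ↥(B6SectA.gaugeSpace Qp), Real.exp (-(1 / 2) * ⟪(l : V), (lap ∘ₗ lap) l⟫_ℝ) ∂μ' =
      ∫ l : ↥(B6SectA.gaugeSpace Qp), Real.exp (-(1 / 2) * ⟪(l : V), (lap ∘ₗ lap) l⟫_ℝ) *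
        (⟪(l : V), a⟫_ℝ * ⟪(l : V), b⟫_ℝ) ∂μ' := by
    simp_rw [inner_lap_lap lap hlap]; exact hT
  obtain ⟨hr, hs, hi, hmgf⟩ :=
    covariance_of_moments (B6SectA.gaugeSpace Qp) μ' (lap ∘ₗ lap) (lap_lap_symm lap hlap) hγ hcoer T hT'
  simp_rw [inner_lap_lap lap hlap] at hmgf
  exact ⟨hr, hs, fun n hn => hi ⟨n, hn⟩, hmgf⟩

/-- **(2.26) AS PRINTED: *"Let us denote by 𝒢 a covariance of the Gaussian integral on the right-hand side above.
Thus we have R = Δ𝒢Δ."***  With `R` the orthogonal projection onto `ΔN(Q′)` ((2.10)) and `T` a covariance of (2.25):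
(2.25) (`…B6Eq295.eq225`) and `cov225` (d) at the source `Δf` give `e^{½⟨f,Rf⟩}Z′ = e^{½⟨Δf,TΔf⟩}Z′` with `Z′ > 0`,
hence `⟨f,Rf⟩ = ⟨f,ΔTΔf⟩` for all `f`, hence (both operators symmetric: polarization) `Rf = Δ(T(Δf))` for every `f`.
[cite: Balaban1984PropagatorsII, (2.26) p.226] -/
theorem eq226_gaussian (K : Submodule ℝ V) [K.HasOrthogonalProjection] (hK : K = (B6SectA.gaugeSpace Qp).map lap)
    (Rp : V →ₗ[ℝ] V) (hR : ∀ g, Rp g = K.starProjection g) (f : V) :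
    Rp f = lap (T (lap f)) := by
  obtain ⟨-, hTs, -, hmgf⟩ := cov225 Qp μ' lap hlap hDinj T hT
  set D : ↥(B6SectA.gaugeSpace Qp) →ₗ[ℝ] V := lap ∘ₗ (B6SectA.gaugeSpace Qp).subtype with hD
  have hKD : LinearMap.range D = K := by
    rw [hK, hD, LinearMap.range_comp, Submodule.range_subtype]
  have hZ := (cov225_exists Qp μ' lap hlap hDinj).1
  -- the quadratic forms agree: (2.25) versus the moment-generating function with covariance `T` at the source `Δf`
  have hquad : ∀ g : V, ⟪g, Rp g⟫_ℝ = ⟪g, lap (T (lap g))⟫_ℝ := by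
    intro g
    have h225 := B6Eq295.eq225 μ' D K hKD Rp hR g
    have hint_eq : ∀ l : ↥(B6SectA.gaugeSpace Qp), ⟪g, D l⟫_ℝ = ⟪(l : V), lap g⟫_ℝ := fun l => by
      show ⟪g, lap (l : V)⟫_ℝ = ⟪(l : V), lap g⟫_ℝ
      rw [← hlap, real_inner_comm]
    have hDl : ∀ l : ↥(B6SectA.gaugeSpace Qp), ‖D l‖ = ‖lap (l : V)‖ := fun l => rfl
    simp_rw [hint_eq, hDl] at h225
    have h1 := Real.exp_injective (mul_right_cancel₀ hZ.ne' (h225.symm.trans (hmgf (lap g))))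
    have h3 : ⟪g, Rp g⟫_ℝ = ⟪lap g, T (lap g)⟫_ℝ := by linarith
    rw [h3, ← hlap]
  -- polarization
  have hRsym : ∀ x y : V, ⟪Rp x, y⟫_ℝ = ⟪x, Rp y⟫_ℝ := fun x y => by
    rw [hR, hR]; exact Submodule.inner_starProjection_left_eq_right K x y
  have hBsym : (Rp - lap ∘ₗ T ∘ₗ lap).IsSymmetric := by
    intro x y
    simp only [LinearMap.sub_apply, LinearMap.comp_apply, inner_sub_left, inner_sub_right]
    rw [hRsym, hlap, hTs, hlap]
  have hB0 : Rp - lap ∘ₗ T ∘ₗ lap = 0 := by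
    refine hBsym.inner_map_self_eq_zero.mp fun x => ?_
    simp only [LinearMap.sub_apply, LinearMap.comp_apply, inner_sub_left]
    rw [real_inner_comm x (Rp x), real_inner_comm x (lap (T (lap x))), hquad x, sub_self]
  simpa [sub_eq_zero] using LinearMap.congr_fun hB0 f

/-- **(2.27) BY THE GAUSSIAN ROUTE: *"It is easy to see that 𝒢 = G′² − G′²Q′*(Q′G′²Q′*)⁻¹Q′G′²."***  A covariance `T`
of (2.25) EQUALS `…B6SectA.calG G′ Q′ Q′* E` — by `cov225` and r03's `…B6SectA.eq_calG_of_covariance`, property (c)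
being transported from `Δ` to `Δ′_a = Δ + Q′*aQ′` (= `Δ` on `N(Q′)`, `…B6SectA.deltaPrime_apply_of_mem_ker`).
Letters as in `…B6SectA`: `a` symmetric, `Q′*` the adjoint of `Q′`, `G′` a symmetric left inverse of `Δ′_a`, `E` a
symmetric right inverse of `Q′G′²Q′*`. [cite: Balaban1984PropagatorsII, (2.27) p.227] -/
theorem eq227_gaussian (Qps : W →ₗ[ℝ] V) (a : W →ₗ[ℝ] W) (Gp : V →ₗ[ℝ] V) (E : W →ₗ[ℝ] W)
    (hadj : ∀ (w : W) (v : V), ⟪Qps w, v⟫_ℝ = ⟪w, Qp v⟫_ℝ) (ha : ∀ w w' : W, ⟪a w, w'⟫_ℝ = ⟪w, a w'⟫_ℝ)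
    (hsym : ∀ x y : V, ⟪Gp x, y⟫_ℝ = ⟪x, Gp y⟫_ℝ) (hE : ∀ w w' : W, ⟪E w, w'⟫_ℝ = ⟪w, E w'⟫_ℝ)
    (hr : Gp ∘ₗ B6SectA.deltaPrime lap Qp Qps a = LinearMap.id)
    (hE1 : (Qp ∘ₗ (Gp ∘ₗ Gp) ∘ₗ Qps) ∘ₗ E = LinearMap.id) :
    T = B6SectA.calG Gp Qp Qps E := by
  obtain ⟨hTr, hTs, hTi, -⟩ := cov225 Qp μ' lap hlap hDinj T hT
  set Dp := B6SectA.deltaPrime lap Qp Qps a with hDp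
  have hadj' : ∀ (v : V) (w : W), ⟪v, Qps w⟫_ℝ = ⟪Qp v, w⟫_ℝ := fun v w => by
    rw [real_inner_comm, hadj, real_inner_comm]
  have hDsym : ∀ x y : V, ⟪Dp x, y⟫_ℝ = ⟪x, Dp y⟫_ℝ := by
    intro x y
    simp only [hDp, B6SectA.deltaPrime, LinearMap.add_apply, LinearMap.comp_apply, inner_add_left,
      inner_add_right]
    rw [hlap, hadj, ha, ← hadj']
  -- (c) for `Δ′_a`: `T(Δ′_aΔ′_aλ) = λ` on `N(Q′)`, from (c) for `Δ` and `Δ′_a = Δ` on `N(Q′)`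
  have hDp_mem : ∀ n ∈ B6SectA.gaugeSpace Qp, Dp n = lap n := fun n hn =>
    B6SectA.deltaPrime_apply_of_mem_ker lap Qp Qps a hn
  have hTi' : ∀ n ∈ B6SectA.gaugeSpace Qp, T (Dp (Dp n)) = n := by
    intro n hn
    refine ext_inner_left ℝ fun y => ?_
    calc ⟪y, T (Dp (Dp n))⟫_ℝ = ⟪Dp (T y), Dp n⟫_ℝ := by rw [← hTs, hDsym]
      _ = ⟪T y, lap (lap n)⟫_ℝ := by rw [hDp_mem _ (hTr y), hDp_mem _ hn, hlap]
      _ = ⟪y, n⟫_ℝ := by rw [hTs, hTi n hn]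
  exact B6SectA.eq_calG_of_covariance Dp Gp T Qp Qps E hDsym hsym hadj hE hr hE1 hTr hTs hTi'

/-- **(2.25)–(2.27) ⇒ (2.17) end-to-end by the Gaussian route:** *"This formula [(2.27)], the equality (2.26) and the
equalities Q′𝒢 = 𝒢Q′* = 0 imply the representation (2.17)"* — `R = I − G′Q′*(Q′G′²Q′*)⁻¹Q′G′` (`…B6SectA.repr217`)
for the orthogonal projection `R` onto `ΔN(Q′)`, via `eq226_gaussian`, `eq227_gaussian` and r03's algebra
`…B6SectA.conj_calG_eq_lap_calG_lap` / `deltaPrime_calG_deltaPrime` (`G′` a two-sided inverse of `Δ′_a`, `E` of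
`Q′G′²Q′*`).  The direct proof, without Gaussian integrals, is `…B6SectA.starProjection_eq_repr217`.
[cite: Balaban1984PropagatorsII, (2.26)–(2.27) ⇒ (2.17) p.227] -/
theorem eq217_gaussian (Qps : W →ₗ[ℝ] V) (a : W →ₗ[ℝ] W) (Gp : V →ₗ[ℝ] V) (E : W →ₗ[ℝ] W)
    (hadj : ∀ (w : W) (v : V), ⟪Qps w, v⟫_ℝ = ⟪w, Qp v⟫_ℝ) (ha : ∀ w w' : W, ⟪a w, w'⟫_ℝ = ⟪w, a w'⟫_ℝ)
    (hsym : ∀ x y : V, ⟪Gp x, y⟫_ℝ = ⟪x, Gp y⟫_ℝ) (hE : ∀ w w' : W, ⟪E w, w'⟫_ℝ = ⟪w, E w'⟫_ℝ)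
    (hl : B6SectA.deltaPrime lap Qp Qps a ∘ₗ Gp = LinearMap.id)
    (hr : Gp ∘ₗ B6SectA.deltaPrime lap Qp Qps a = LinearMap.id)
    (hE1 : (Qp ∘ₗ (Gp ∘ₗ Gp) ∘ₗ Qps) ∘ₗ E = LinearMap.id) (hE2 : E ∘ₗ (Qp ∘ₗ (Gp ∘ₗ Gp) ∘ₗ Qps) = LinearMap.id)
    (K : Submodule ℝ V) [K.HasOrthogonalProjection] (hK : K = (B6SectA.gaugeSpace Qp).map lap)
    (Rp : V →ₗ[ℝ] V) (hR : ∀ g, Rp g = K.starProjection g) (f : V) :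
    Rp f = B6SectA.repr217 Gp Qp Qps E f := by
  rw [eq226_gaussian Qp μ' lap hlap hDinj T hT K hK Rp hR f,
    eq227_gaussian Qp μ' lap hlap hDinj T hT Qps a Gp E hadj ha hsym hE hr hE1]
  have h := (B6SectA.conj_calG_eq_lap_calG_lap lap Gp Qp Qps a E hE1 hE2).symm.trans
    (B6SectA.deltaPrime_calG_deltaPrime (B6SectA.deltaPrime lap Qp Qps a) Gp Qp Qps E hl hr)
  simpa [LinearMap.comp_apply] using LinearMap.congr_fun h f

/-- **(2.26) in bilinear form — the hypothesis `h226` of `…B6Eq228FaddeevPopov.eq230_line3_calG` DISCHARGED** (v1.1):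
for a covariance `T` of (2.25) and the orthogonal projection `R` onto `ΔN(Q′)`, `⟨x, Ry⟩ = ⟨Δx, T(Δy)⟩` for all `x, y`
— so the third line of (2.30) (*"The last equality follows from the identity (2.26)"*, p. 227) holds with `𝒢 :=` the
covariance of the Gaussian (2.25). [cite: Balaban1984PropagatorsII, (2.26) p.226 + (2.30) p.227] -/
theorem h226_of_cov (K : Submodule ℝ V) [K.HasOrthogonalProjection] (hK : K = (B6SectA.gaugeSpace Qp).map lap)
    (Rp : V →ₗ[ℝ] V) (hR : ∀ g, Rp g = K.starProjection g) (x y : V) :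
    ⟪x, Rp y⟫_ℝ = ⟪lap x, T (lap y)⟫_ℝ := by
  rw [eq226_gaussian Qp μ' lap hlap hDinj T hT K hK Rp hR y, hlap]

end SectA

end Literature.MathematicalPhysics.QuantumFieldTheory.Balaban1983to89.B6Eq226CovarianceMoments

end
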